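import Summits.BirchSwinnertonDyer.Rank1Residual.X11a.MuLambdaSplit
import HarnessLib

/-!
# Class X11a, surjective image: `μ(X(E/ℚ_∞)) = 0` from the per-pair certificate `μ^an(E,p) = 0`
# and Kato's divisibility (cell `b2b-bsdres`, unit `b2b-bsdres-x11a`, gen 14)

HONEST FRAMING (run/shared/lean/b2b/bsd-rank1-residual/, verbatim in every file): the goal of the
cell is to DELETE the COMBINATION-SHAPED residual classes of the Birch–Swinnerton-Dyer formula for
ALL analytic-rank `≤ 1` elliptic curves over `ℚ` — "full BSD formula for every rank `≤ 1` curve in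
class `C`" assembled STRICTLY from published theorems — so that the rank-`≤ 1` remainder becomes
exactly the CONSTRUCTION-SHAPED classes, which are TYPED (missing-input `Prop`s), NOT attempted.
This is not "finishing BSD". Research route; NO CLAIM BEYOND STATED CLASSES. Theorems only (no
definition, no named fact); companion of `X11a/MuLambdaSplit.lean`.

The companion file proves, under the shared quantifier prefix `InvariantsAt` (every newform, every
`ϖ`, every dual datum, every generator, every Kato element), that the certificate
`X11a.MuAnZeroAt W p` plus Kato's divisibility for surjective image forces unit content of the
generator of `char_Λ X(E/ℚ_∞)`. This file INSTANTIATES the prefix from tree theorems — the newform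
and `ϖ > 0` from a modular parametrisation datum (`hpar`), THE Mazur–Tate–Teitelbaum function
(`exists_isSplitMultPAdicLFunctionOf` / `exists_isMultPAdicLFunctionOf_neg_one_of_nonsplit`), a
generator (`charIdeal_isPrincipal_holds`) — and states the conclusion prefix-free, in the tree's
INTRINSIC invariant `SelmerDualData.mu`:

* `isTorsion_and_exists_generator_hasUnitContent_of_muAnZeroAt` — `W/ℚ` globally minimal,
  `p ≥ 5`, `p ‖ N`, `ρ̄_{E,p}` surjective, `MuAnZeroAt W p`: for every cyclotomic datum `(κ, γ)` and
  every dual datum `D` of `Sel_{p^∞}(E/ℚ_∞)`, `X = D.X` is `Λ`-torsion and `char_Λ X = (fE)` with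
  `fE` of unit content.
* `selmerDual_mu_eq_zero_of_muAnZeroAt` — hence **`μ(X(E/ℚ_∞)) = 0`** (`D.mu = 0`, Greenberg–Vatsal
  (1) ⟺ (2): `GreenbergVatsal2000.mu_eq_zero_iff_hasUnitContent`). This is Greenberg's `μ = 0`
  conjecture (LNM 1716 Conj. 1.11, for irreducible `E[p]`) AT THE PAIR, as a theorem of ONE finite
  certificate and the published record (Kato–Wuthrich A32) — no rank hypothesis, no (ram).
* `forall_selmerDual_mu_eq_zero_of_certificate` — class-level reading on X11a's surjective part.

Census (lane, informational): the Iwasawa lanes report `μ_an = 0` on all 1663 irreducible-batch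
pairs and iw-2 certified it for the 10 open extended-leaf pairs (HOME/b2b-bsdres-iw-2/MU-CERTIFICATES.md,
job j080269); at each such pair with `p ≥ 5`, `p ‖ N`, `ρ̄` surjective this file gives `μ^alg = 0`.

References: [GreenbergLNM1716] Conj. 1.11, Thm. 1.5; [GreenbergVatsal2000] p. 2 (1)–(2), p. 3
(results A–C); [Wuthrich2014] Thm. 3, Cor. 19; [EmertonPollackWeston2006] Thm. 1 (`μ` is an
invariant of `ρ̄`), Thm. 5.1.2; HOME/b2b-bsdres-x11a/X11A-CHAIN.md step [L4].
-/

set_option autoImplicit false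

noncomputable section

open scoped Classical MatrixGroups ModularForm

open CongruenceSubgroup WeierstrassCurve Literature.NumberTheory.EllipticCurves
  Literature.NumberTheory.EllipticCurves.ModularForms
  Literature.NumberTheory.EllipticCurves.Rank1Residual
  Literature.NumberTheory.EllipticCurves.Rank1Residual.Typed
  Literature.NumberTheory.EllipticCurves.Wuthrich2014
  Literature.NumberTheory.EllipticCurves.GreenbergVatsal2000
  Literature.NumberTheory.EllipticCurves.EmertonPollackWeston2006
  Summit.BirchSwinnertonDyer.Rank1Residual.X1.MuLambda

namespace Summit.BirchSwinnertonDyer.Rank1Residual.X11a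

variable (W : WeierstrassCurve ℚ) [W.IsElliptic] [W.IsGloballyMinimal] (p : ℕ) [Fact p.Prime]

/-- **`X(E/ℚ_∞)` is torsion and its characteristic ideal has a generator of unit content**, at a
multiplicative `p ≥ 5` with `ρ̄_{E,p}` surjective, from the certificate `MuAnZeroAt W p` and Kato's
divisibility (`hKato`), for EVERY cyclotomic datum and EVERY dual datum: the universally
quantified `invariantsAt_hasUnitContent_generator_of_muAnZeroAt` instantiated at the newform and
`ϖ` of a modular parametrisation datum (`hpar`), THE Mazur–Tate–Teitelbaum function (tree
existence theorems) and Kato's element. [cite: Wuthrich2014, Thm. 3 (p. 382) and Cor. 19 proof (p. 399)]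
[cite: GreenbergVatsal2000, p. 2–3, (1)–(2)] -/
theorem isTorsion_and_exists_generator_hasUnitContent_of_muAnZeroAt
    (hKato : kato_charIdeal_dvd_multiplicative_of_surjective)
    (hpar : nonempty_modularParametrizationData)
    (hp : 5 ≤ p) (hmult : W.HasMultiplicativeReductionAtPrime p)
    (hsurj : W.HasSurjectiveModNGaloisRep p) (hμ : MuAnZeroAt W p)
    {κ : ZpExtension ℚ p} {γ : Field.absoluteGaloisGroup ℚ} (hκ : κ.IsCyclotomic)
    (hγ : κ.IsTopGenerator γ) (hγ' : IsCyclotomicVariable p γ) (D : W.SelmerDualData κ γ) :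
    D.IsTorsion ∧ ∃ fE : IwasawaAlgebra p, D.charIdeal = Ideal.span {fE} ∧ HasUnitContent fE := by
  haveI : NeZero (W.conductorNorm ℤ) := ⟨(W.conductorNorm_pos_holds).ne'⟩
  obtain ⟨Dm⟩ := hpar W
  obtain ⟨ϖ, -, hϖ, -⟩ := Dm.exists_rat_mul_realPeriodRat_eq_plusPeriod
  have hp2 : p ≠ 2 := by omega
  have hsurj' : ∀ n : ℕ, W.HasSurjectiveModNGaloisRep (p ^ n : ℕ) :=
    kato_charIdeal_dvd_multiplicative_of_surjective.surjective_pow_of_five_le W p hp hsurj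
  obtain ⟨hX, hKns, hKs⟩ := hKato W p hp2 hmult hsurj' hκ hγ hγ' Dm.isNewformOf D ϖ hϖ
  haveI : (Literature.NumberTheory.EllipticCurves.Module.charIdeal (IwasawaAlgebra p) D.X).IsPrincipal :=
    charIdeal_isPrincipal_holds p D.X
  obtain ⟨fE, hfE⟩ := Submodule.IsPrincipal.principal
    (Literature.NumberTheory.EllipticCurves.Module.charIdeal (IwasawaAlgebra p) D.X)
  have hchar : D.charIdeal = Ideal.span {fE} := hfE
  refine ⟨hX, fE, hchar, ?_⟩
  have key := invariantsAt_hasUnitContent_generator_of_muAnZeroAt W p hKato hp hmult hsurj hμ κ γ hκ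
    hγ hγ' Dm.f Dm.isNewformOf D ϖ hϖ fE
  by_cases hsplit : W.HasSplitMultiplicativeReductionAtPrime p
  · obtain ⟨L, hL⟩ := exists_isSplitMultPAdicLFunctionOf hsplit Dm.isNewformOf
    obtain ⟨g, -, hι⟩ := hKs hsplit L hL
    exact ((key g hchar).2 hsplit L hL hι).2.1
  · obtain ⟨L, hL⟩ := exists_isMultPAdicLFunctionOf_neg_one_of_nonsplit Dm.isNewformOf hmult hsplit
    obtain ⟨g, -, hι⟩ := hKns hsplit L hL
    exact ((key g hchar).1 hsplit L hL hι).2.1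

/-- **`μ(X(E/ℚ_∞)) = 0` at the pair** — Greenberg's `μ`-conjecture (LNM 1716 Conj. 1.11) for THIS
`(E, p)`: `p ≥ 5` multiplicative, `ρ̄_{E,p}` surjective, and the finite certificate `μ^an(E,p) = 0`
(`MuAnZeroAt W p`) — as a theorem of the published record (Kato–Wuthrich A32 `hKato`; a modular
parametrisation datum `hpar`); `D.mu` is the tree's intrinsic `μ`-invariant of the Iwasawa module
(`GreenbergVatsal2000.mu_eq_zero_iff_hasUnitContent`: `μ = 0` ⟺ unit content of a generator).
No rank hypothesis, no (ram). [cite: GreenbergLNM1716, Conj. 1.11 and Thm. 1.5 (PDF p. 61)]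
[cite: GreenbergVatsal2000, p. 2, (1)–(2)] [cite: Wuthrich2014, Thm. 3 (p. 382) and Cor. 19 proof (p. 399)] -/
theorem selmerDual_mu_eq_zero_of_muAnZeroAt
    (hKato : kato_charIdeal_dvd_multiplicative_of_surjective)
    (hpar : nonempty_modularParametrizationData)
    (hp : 5 ≤ p) (hmult : W.HasMultiplicativeReductionAtPrime p)
    (hsurj : W.HasSurjectiveModNGaloisRep p) (hμ : MuAnZeroAt W p)
    {κ : ZpExtension ℚ p} {γ : Field.absoluteGaloisGroup ℚ} (hκ : κ.IsCyclotomic)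
    (hγ : κ.IsTopGenerator γ) (hγ' : IsCyclotomicVariable p γ) (D : W.SelmerDualData κ γ) :
    D.mu = 0 := by
  obtain ⟨hX, fE, hchar, hfE⟩ := isTorsion_and_exists_generator_hasUnitContent_of_muAnZeroAt W p
    hKato hpar hp hmult hsurj hμ hκ hγ hγ' D
  haveI : Module.Finite (IwasawaAlgebra p) D.X := D.module_finite_holds hγ
  exact (GreenbergVatsal2000.mu_eq_zero_iff_hasUnitContent D hX hchar).mpr hfE

/-- **Class-level reading (X11a ∪ row C1, surjective image, `p ≥ 5`)**: at every pair `(E, p)` with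
`p ‖ N`, `p ≥ 5`, `ρ̄_{E,p}` surjective that carries the certificate `μ^an(E,p) = 0`, the
`μ`-invariant of `X(E/ℚ_∞)` vanishes for every cyclotomic datum and every dual datum — the
algebraic half of "`μ^alg(ρ̄) = μ^an(ρ̄) = 0`", the standing hypothesis of Emerton–Pollack–Weston's
Thm. 2 / Cor. 5.1.4, supplied per pair. [cite: EmertonPollackWeston2006, Thm. 1 and Thm. 2 (hypothesis μ = 0)]
[cite: GreenbergLNM1716, Conj. 1.11] -/
theorem forall_selmerDual_mu_eq_zero_of_certificate
    (hKato : kato_charIdeal_dvd_multiplicative_of_surjective)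
    (hpar : nonempty_modularParametrizationData) :
    ∀ (W : WeierstrassCurve ℚ) [W.IsElliptic] [W.IsGloballyMinimal] (p : ℕ) [Fact p.Prime],
      5 ≤ p → Mult W p → Surj W p → MuAnZeroAt W p →
      ∀ {κ : ZpExtension ℚ p} {γ : Field.absoluteGaloisGroup ℚ}, κ.IsCyclotomic →
        κ.IsTopGenerator γ → IsCyclotomicVariable p γ → ∀ D : W.SelmerDualData κ γ, D.mu = 0 := by
  intro W _ _ p _ hp hmult hsurj hμ κ γ hκ hγ hγ' D
  exact selmerDual_mu_eq_zero_of_muAnZeroAt W p hKato hpar hp hmult hsurj hμ hκ hγ hγ' D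

end Summit.BirchSwinnertonDyer.Rank1Residual.X11a

end
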